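import Mathlib
import Summits.KontsevichZagierPeriods.Zeta5Search.Elimination.DictPencilFull
import Summits.KontsevichZagierPeriods.Zeta5Search.Families.DualConstantTermStar35
import Summits.KontsevichZagierPeriods.Zeta5Search.Certificates.BinomialSumBounds
import HarnessLib

/-!
# Signed descent, part 1 of 2: the generic region descent, the sign of `Q`, the thin constant-term nodes (fam-elim E-L29a)

HONEST FRAMING: systematic search; no irrationality claim unless certified.  This file is bookkeeping about
identities between INTEGERS (Brown–Zudilin's leading coefficient `Q(a)` of (17) and the dual constant term
`dualConstantTerm a` of `Families/DualConstantTerm`); the constant-term nodes below are HYPOTHESES (plain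
`def … : Prop`, asserted nowhere); nothing is claimed about `ζ(5)`; records unmoved.

This is the first half of fam-elim E-L29 (split at a section boundary for the 400-line filing limit; declarations
byte-identical to the staged single file `HOME/lean/ElimSignedDescent.lean` of gen 29, sha256 `33dce15d…`):
§1 `regionDescent_level` / `regionDescent` (gen-1's terminal descent made generic in the propagated predicate),
§2 `sumP`, `qSign a = (−1)^{Σp(a)}` and its behaviour under the slot / diagonal moves, §3 the nodes `DualCone`,
`CTStarZero`, `CTPencilSlot`, `CTTerminal`, `CTTerminalAbs` with the cone-closure lemmas.  The signed descent itself
(`signed_dexact_of_thin`, `dexact_cone_of_thin_abs`, …) is part 2, `Elimination/SignedDescent.lean`, whose module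
docstring carries the full overview and the evidence.  [pub-zeta5 fam-elim gen 29 (content) / gen 30 (split)]
-/

open Finset

namespace Summit.KontsevichZagierPeriods.Zeta5Search.Elimination

open Summit.KontsevichZagierPeriods.Zeta5Search.WedgeDictionary
open Summit.KontsevichZagierPeriods.Zeta5Search.Families.Cellular (dualConstantTerm bzNum bzDen)
open Literature.NumberTheory.Irrationality.BrownZudilin2022 (bOfA Converges QOf pOf qOf Qcoeff zchoose
  convergenceForms b24 b14 b57 b35 b36)

/-! ## 1. The generic region descent -/

/-- **Generic level descent.** One level `N` of gen-1's terminal descent for an arbitrary predicate `G`: STAR steps at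
apexes with a zero slot and two distinct non-zero slot values, PENCIL steps at interior apexes (base at level `N − 2`,
where `G` is assumed), terminal points assumed. -/
theorem regionDescent_level (G : (Fin 8 → ℤ) → Prop) {N : ℤ}
    (hstar : ∀ (a : Fin 8 → ℤ) (j p q : ℕ), RegionHyp a j → p ∈ Icc 1 7 → q ∈ Icc 1 7 →
      1 ≤ bOfA a p → 1 ≤ bOfA a q → bOfA a p ≠ bOfA a q → (∃ i ∈ Icc 1 7, bOfA a i = 0) →
      G (a + slotDown q) → G (a + slotDown p) → G a)
    (hpencil : ∀ (a : Fin 8 → ℤ) (j : ℕ), RegionHyp a j → (∀ m ∈ Icc 1 7, 1 ≤ bOfA a m) →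
      G (a - dsUp) → (∀ i ∈ Icc 1 7, G (a + slotDown i)) → G a)
    (hlow : ∀ (c : Fin 8 → ℤ) (j : ℕ), bOfA c 0 = N - 2 → RegionHyp c j → G c)
    (hterm : ∀ (a : Fin 8 → ℤ) (j : ℕ), bOfA a 0 = N → Terminal a → RegionHyp a j → G a) :
    ∀ (a : Fin 8 → ℤ) (j : ℕ), bOfA a 0 = N → RegionHyp a j → G a := by
  suffices H : ∀ s : ℕ, ∀ (a : Fin 8 → ℤ) (j : ℕ), bOfA a 0 = N → RegionHyp a j → (slotSum a).toNat = s → G a from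
    fun a j hN hr => H _ a j hN hr rfl
  intro s
  induction s using Nat.strong_induction_on with
  | _ s ih =>
    intro a j hN hr hs
    have hbox := hr.2.2.1
    have hb1 := hbox 1 (by simp)
    have hb2 := hbox 2 (by simp)
    have hb3 := hbox 3 (by simp)
    have hb4 := hbox 4 (by simp)
    have hb5 := hbox 5 (by simp)
    have hb6 := hbox 6 (by simp)
    have hb7 := hbox 7 (by simp)
    have hss : 0 ≤ slotSum a := by
      simp only [slotSum]
      omega
    by_cases hpos : ∀ i ∈ Icc 1 7, 1 ≤ bOfA a i
    · -- PENCIL step: base `a − DS` (level `N − 2`), sons `a − s_i` (smaller slot sum)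
      have h₀ : G (a - dsUp) :=
        hlow (a - dsUp) j (by rw [bOfA_sub_dsUp a 0 (by norm_num), if_pos rfl, hN]) (regionHyp_sub_dsUp hr hpos)
      refine hpencil a j hr hpos h₀ fun i hi => ?_
      have hi1 : 1 ≤ i := (mem_Icc.1 hi).1
      have hge : bOfA a i ≤ slotSum a := le_slotSum hr hi
      have hpi := hpos i hi
      have hlt : (slotSum (a + slotDown i)).toNat < s := by
        rw [slotSum_add_slotDown a hi]
        omega
      have hN' : bOfA (a + slotDown i) 0 = N := by
        rw [bOfA_add_slotDown a i hi 0 (by norm_num), if_neg (by omega)]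
        exact hN
      exact ih _ hlt (a + slotDown i) j hN' (regionHyp_slotDown hr hi hpi) rfl
    · push Not at hpos
      obtain ⟨i₀, hi₀, hz⟩ := hpos
      have hzero : ∃ i ∈ Icc 1 7, bOfA a i = 0 := ⟨i₀, hi₀, by have := hbox i₀ hi₀; omega⟩
      by_cases hdis : ∃ p ∈ Icc 1 7, ∃ q ∈ Icc 1 7, bOfA a p ≠ 0 ∧ bOfA a q ≠ 0 ∧ bOfA a p ≠ bOfA a q
      · -- STAR step: both sons have smaller slot sum
        obtain ⟨p, hp, q, hq, hp0, hq0, hpq⟩ := hdis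
        have hp1 : 1 ≤ bOfA a p := by
          have := hbox p hp
          omega
        have hq1 : 1 ≤ bOfA a q := by
          have := hbox q hq
          omega
        have hp' : 1 ≤ p := (mem_Icc.1 hp).1
        have hq' : 1 ≤ q := (mem_Icc.1 hq).1
        have hNq : bOfA (a + slotDown q) 0 = N := by
          rw [bOfA_add_slotDown a q hq 0 (by norm_num), if_neg (show (0 : ℕ) ≠ q by omega)]
          exact hN
        have hNp : bOfA (a + slotDown p) 0 = N := by
          rw [bOfA_add_slotDown a p hp 0 (by norm_num), if_neg (show (0 : ℕ) ≠ p by omega)]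
          exact hN
        have hgeq : bOfA a q ≤ slotSum a := le_slotSum hr hq
        have hltq : (slotSum (a + slotDown q)).toNat < s := by
          rw [slotSum_add_slotDown a hq]
          omega
        have hltp : (slotSum (a + slotDown p)).toNat < s := by
          rw [slotSum_add_slotDown a hp]
          have hgep : bOfA a p ≤ slotSum a := le_slotSum hr hp
          omega
        have h₁ : G (a + slotDown q) := ih _ hltq (a + slotDown q) j hNq (regionHyp_slotDown hr hq hq1) rfl
        have h₂ : G (a + slotDown p) := ih _ hltp (a + slotDown p) j hNp (regionHyp_slotDown hr hp hp1) rfl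
        exact hstar a j p q hr hp hq hp1 hq1 hpq hzero h₁ h₂
      · -- terminal point
        have hT : Terminal a := by
          refine ⟨hzero, ?_⟩
          intro p hp q hq hp0 hq0
          by_contra hne
          exact hdis ⟨p, hp, q, hq, hp0, hq0, hne⟩
        exact hterm a j hN hT hr

/-- **THE GENERIC REGION DESCENT (PROVED).**  A predicate `G` on `ℤ⁸` that passes up STAR steps (apex with a zero
slot, sons `a − s_q`, `a − s_p` with `b_p ≠ b_q` both `≥ 1`) and PENCIL steps (interior apex, base `a − DS`, sons
`a − s_i`), and holds at every terminal region point given all region points of lower level, holds at every region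
point.  (`G := ExplicitPQAt · j`-free predicates only: the partner index is carried by `RegionHyp` but not by `G`.) -/
theorem regionDescent (G : (Fin 8 → ℤ) → Prop)
    (hstar : ∀ (a : Fin 8 → ℤ) (j p q : ℕ), RegionHyp a j → p ∈ Icc 1 7 → q ∈ Icc 1 7 →
      1 ≤ bOfA a p → 1 ≤ bOfA a q → bOfA a p ≠ bOfA a q → (∃ i ∈ Icc 1 7, bOfA a i = 0) →
      G (a + slotDown q) → G (a + slotDown p) → G a)
    (hpencil : ∀ (a : Fin 8 → ℤ) (j : ℕ), RegionHyp a j → (∀ m ∈ Icc 1 7, 1 ≤ bOfA a m) →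
      G (a - dsUp) → (∀ i ∈ Icc 1 7, G (a + slotDown i)) → G a)
    (hterm : ∀ (a : Fin 8 → ℤ) (j : ℕ), Terminal a → RegionHyp a j →
      (∀ (c : Fin 8 → ℤ) (j' : ℕ), bOfA c 0 < bOfA a 0 → RegionHyp c j' → G c) → G a) :
    ∀ (a : Fin 8 → ℤ) (j : ℕ), RegionHyp a j → G a := by
  suffices H : ∀ n : ℕ, ∀ (a : Fin 8 → ℤ) (j : ℕ), (bOfA a 0).toNat = n → RegionHyp a j → G a from
    fun a j hr => H _ a j rfl hr
  intro n
  induction n using Nat.strong_induction_on with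
  | _ n ih =>
    intro a j hn hr
    have hN0 : 0 ≤ bOfA a 0 := level_nonneg hr
    refine regionDescent_level G (N := bOfA a 0) hstar hpencil ?_ ?_ a j rfl hr
    · intro c j' hc hr'
      have hc0 : 0 ≤ bOfA c 0 := level_nonneg hr'
      have hlt : (bOfA c 0).toNat < n := by
        rw [← hn]
        omega
      exact ih _ hlt c j' rfl hr'
    · intro a' j' ha' hT hr'
      refine hterm a' j' hT hr' ?_
      intro c j'' hlt' hrc
      have hc0 : 0 ≤ bOfA c 0 := level_nonneg hrc
      exact ih _ (by omega) c j'' rfl hrc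

/-! ## 2. The sign of `Q` along the moves -/

/-- `Σ_i p_i(a)`, the exponent of the sign in (17). -/
def sumP (a : Fin 8 → ℤ) : ℤ := ∑ i, pOf a i

/-- `Σp` in closed form. (docstring added by the filing lane, P2 g7) -/
theorem sumP_eq (a : Fin 8 → ℤ) :
    sumP a = a 0 + 3 * a 1 + 3 * a 2 - 2 * a 3 + a 4 + 6 * a 5 + a 6 - 5 * a 7 := by
  simp [sumP, pOf, Fin.sum_univ_seven]
  ring

/-- In dual coordinates: `Σp = 7b₀ − 7b₆ − Σ_{i ≠ 6} b_i`. -/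
theorem sumP_eq_bOfA (a : Fin 8 → ℤ) :
    sumP a = 7 * bOfA a 0 - bOfA a 1 - bOfA a 2 - bOfA a 3 - bOfA a 4 - bOfA a 5 - 7 * bOfA a 6 - bOfA a 7 := by
  rw [sumP_eq]
  simp [bOfA]
  ring

/-- A slot move raises `Σp` by `1` (`k ≠ 6`) or by `7` (`k = 6`). -/
theorem sumP_add_slotDown (a : Fin 8 → ℤ) {k : ℕ} (hk : k ∈ Icc 1 7) :
    sumP (a + slotDown k) = sumP a + if k = 6 then 7 else 1 := by
  rw [sumP_eq, sumP_eq]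
  simp only [mem_Icc] at hk
  obtain ⟨h1, h7⟩ := hk
  interval_cases k <;> simp [slotDown] <;> ring

/-- The PENCIL base has `Σp` one less. -/
theorem sumP_sub_dsUp (a : Fin 8 → ℤ) : sumP (a - dsUp) = sumP a - 1 := by
  rw [sumP_eq, sumP_eq]
  simp [dsUp]
  ring

/-- The sign `(−1)^{Σp(a)}` as a unit-valued function of the INTEGER `Σp` (no truncation). -/
def qSign (a : Fin 8 → ℤ) : ℤ := ((sumP a).negOnePow : ℤ)

/-- `|qSign a| = 1`. (docstring added by the filing lane, P2 g7) -/
theorem abs_qSign (a : Fin 8 → ℤ) : |qSign a| = 1 := Int.abs_negOnePow _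

/-- `qSign a ^ 2 = 1`. (docstring added by the filing lane, P2 g7) -/
theorem qSign_mul_self (a : Fin 8 → ℤ) : qSign a * qSign a = 1 := by
  unfold qSign
  rcases Int.units_eq_one_or (sumP a).negOnePow with h | h <;> simp [h]

/-- The sign flips under every slot move. -/
theorem qSign_add_slotDown (a : Fin 8 → ℤ) {k : ℕ} (hk : k ∈ Icc 1 7) : qSign (a + slotDown k) = -qSign a := by
  unfold qSign
  rw [sumP_add_slotDown a hk]
  split_ifs
  · rw [show sumP a + 7 = sumP a + 1 + 2 * 3 by ring, Int.negOnePow_add, Int.negOnePow_two_mul,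
      mul_one, Int.negOnePow_succ, Units.val_neg]
  · rw [Int.negOnePow_succ, Units.val_neg]

/-- The sign flips between the PENCIL base `a − DS` and the apex `a`. -/
theorem qSign_sub_dsUp (a : Fin 8 → ℤ) : qSign (a - dsUp) = -qSign a := by
  unfold qSign
  rw [sumP_sub_dsUp, Int.negOnePow_sub, Int.negOnePow_one, Units.val_mul, Units.val_neg, Units.val_one]
  ring

/-- If `Σp(a) ≥ 0` the sign is the one of (17): `Q(a) = qSign(a)·|Q(a)|` as soon as the double sum is `≥ 0`
(bookkeeping form: `(−1)^{(Σp).toNat} = qSign a`). -/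
theorem neg_one_pow_toNat_eq_qSign {a : Fin 8 → ℤ} (h : 0 ≤ sumP a) :
    ((-1 : ℤ) ^ (sumP a).toNat) = qSign a := by
  unfold qSign
  rw [← Int.coe_negOnePow_natCast, Int.toNat_of_nonneg h]

/-- `|Q(a)|` is the sign-free double sum of (17) (`BinomialSum.Qcoeff_eq`, `Certificates/BinomialSumBounds`). -/
theorem abs_QOf (a : Fin 8 → ℤ) :
    |QOf a| = ∑ k₁ ∈ Finset.Icc (pOf a 1) (pOf a 1 + qOf a 0), ∑ k₂ ∈ Finset.Icc (pOf a 4) (pOf a 4 + qOf a 3),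
      BinomialSum.qTerm (pOf a) (qOf a) k₁ k₂ := by
  rw [show QOf a = Qcoeff (pOf a) (qOf a) from rfl, BinomialSum.Qcoeff_eq, abs_mul, abs_pow, abs_neg, abs_one,
    one_pow, one_mul, abs_of_nonneg (BinomialSum.sum_qTerm_nonneg _ _)]

/-- For `Σp(a) ≥ 0` the sign of `Q(a)` is `qSign a`. -/
theorem QOf_eq_qSign_mul_abs {a : Fin 8 → ℤ} (h : 0 ≤ sumP a) : QOf a = qSign a * |QOf a| := by
  rw [abs_QOf, ← neg_one_pow_toNat_eq_qSign h]
  rfl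

/-! ## 3. The three thin constant-term nodes (HYPOTHESES — asserted nowhere) -/

/-- Brown–Zudilin's cone on the gap side: all eight `bzDen` exponents are `≥ 0` (the numerator exponents `bzNum` are
`≥ 0` at every convergent point, `bzNum_nonneg`).  On gen-1's region every `bzDen a i` is a slot `b₅, b₇` or
`N − b_x − b_y` (`{x,y} ∈ {17, 27, 16, 45, 35, 46}`), hence `≥ −1`; the cone excludes exactly the corners with two such
slots equal to `(N+1)/2`. -/
def DualCone (a : Fin 8 → ℤ) : Prop := ∀ i, 0 ≤ bzDen a i

/-- At a convergent point all eight numerator exponents `bzNum a` are `≥ 0`. (docstring added by the filing lane, P2 g7) -/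
theorem bzNum_nonneg {a : Fin 8 → ℤ} (hc : Converges a) : ∀ i, 0 ≤ bzNum a i := by
  have hF := forms_of_converges hc
  intro i
  fin_cases i <;> simp [bzNum] <;> omega

/-- The eight gap exponents in dual coordinates. -/
theorem bzDen_eq_bOfA (a : Fin 8 → ℤ) :
    bzDen a 0 = bOfA a 0 - bOfA a 1 - bOfA a 7 ∧ bzDen a 1 = bOfA a 7 ∧ bzDen a 2 = bOfA a 0 - bOfA a 2 - bOfA a 7 ∧
      bzDen a 3 = bOfA a 0 - bOfA a 1 - bOfA a 6 ∧ bzDen a 4 = bOfA a 0 - bOfA a 4 - bOfA a 5 ∧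
        bzDen a 5 = bOfA a 5 ∧ bzDen a 6 = bOfA a 0 - bOfA a 3 - bOfA a 5 ∧
          bzDen a 7 = bOfA a 0 - bOfA a 4 - bOfA a 6 := by
  refine ⟨?_, ?_, ?_, ?_, ?_, ?_, ?_, ?_⟩ <;> simp [bzDen, bOfA, b24, b14, b57, b35, b36] <;> ring

/-- The cone is closed under the slot move `a ↦ a − s_k` at a slot `b_k ≥ 1` (the forms `N − b_x − b_y` do not
decrease; `b₅`, `b₇` drop by one only when `k = 5, 7`). -/
theorem dualCone_add_slotDown {a : Fin 8 → ℤ} (h : DualCone a) {k : ℕ} (hk : k ∈ Icc 1 7) (hpos : 1 ≤ bOfA a k) :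
    DualCone (a + slotDown k) := by
  have hk' := hk
  simp only [mem_Icc] at hk'
  obtain ⟨h1, h7⟩ := hk'
  intro i
  have h0 := h 0; have h1' := h 1; have h2 := h 2; have h3 := h 3; have h4 := h 4; have h5 := h 5; have h6 := h 6
  have h7' := h 7
  simp [bzDen, b24, b14, b57, b35, b36] at h0 h1' h2 h3 h4 h5 h6 h7'
  fin_cases i <;> interval_cases k <;> simp [bzDen, slotDown, bOfA, b24, b14, b57, b35, b36] at hpos ⊢ <;> omega

/-- The cone is closed under `a ↦ a − DS` at an interior point (the forms `N − b_x − b_y` are invariant; the slots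
`b₅ = bzDen a 5`, `b₇ = bzDen a 1` drop by one). -/
theorem dualCone_sub_dsUp {a : Fin 8 → ℤ} (h : DualCone a) (hpos : ∀ m ∈ Icc 1 7, 1 ≤ bOfA a m) :
    DualCone (a - dsUp) := by
  have hb5 := hpos 5 (by simp)
  have hb7 := hpos 7 (by simp)
  simp [bOfA] at hb5 hb7
  intro i
  have h0 := h 0; have h1' := h 1; have h2 := h 2; have h3 := h 3; have h4 := h 4; have h5 := h 5; have h6 := h 6
  have h7' := h 7
  simp [bzDen, b24, b14, b57, b35, b36] at h0 h1' h2 h3 h4 h5 h6 h7'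
  fin_cases i <;> simp [bzDen, dsUp, b24, b14, b57, b35, b36] <;> omega

/-- On the region ∩ cone the sign exponent is non-negative: `Σp = 4N − 6b₆ + d ≥ N − 3` from level `3` on, and the
levels `≤ 2` by the cone inequalities `N ≥ b₁ + b₆`, `N ≥ b₄ + b₆` (the two region points with `Σp = −1`,
`(1; 0,0,0,1,0,1,0)` and `(1; 1,0,0,0,0,1,0)`, lie outside the cone). -/
theorem sumP_nonneg_of_cone {a : Fin 8 → ℤ} {j : ℕ} (hr : RegionHyp a j) (hW : DualCone a) : 0 ≤ sumP a := by
  obtain ⟨-, hconv, hbox, hd, -⟩ := hr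
  have hF := forms_of_converges hconv
  have hb1 := hbox 1 (by simp)
  have hb2 := hbox 2 (by simp)
  have hb3 := hbox 3 (by simp)
  have hb4 := hbox 4 (by simp)
  have hb5 := hbox 5 (by simp)
  have hb6 := hbox 6 (by simp)
  have hb7 := hbox 7 (by simp)
  have h0 := hW 0
  have h3 := hW 3
  have h7 := hW 7
  rw [dOf_bOfA] at hd
  simp only [bOfA] at hb1 hb2 hb3 hb4 hb5 hb6 hb7
  simp [bzDen] at h0 h3 h7
  rw [sumP_eq]
  omega

/-- **STAR node for the dual constant term at zero-slot configurations (HYPOTHESIS; unsigned form).**  At every region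
apex `a` with a zero slot, guard `W a`, and two slots `p, q` with `b_p ≠ b_q` both `≥ 1`:
`κ(p,q)·CT(a) + χ_qΠ_q·CT(a − s_q) − χ_pΠ_p·CT(a − s_p) = 0` — the relation of cert-2's unconditional
`Families.Cellular.dualConstantTerm_star35'` for `(p,q) = (3,5)`; the two sign changes relative to `DictStar` are the
flips `qSign_add_slotDown`.  Configurations with all slots `≥ 1` are NOT demanded (they are PENCIL apexes).
Evidence: 122 760 zero-slot instances of level `≤ 5`, exact. -/
def CTStarZero (W : (Fin 8 → ℤ) → Prop) : Prop :=
  ∀ (a : Fin 8 → ℤ) (j p q : ℕ), RegionHyp a j → W a → p ∈ Icc 1 7 → q ∈ Icc 1 7 →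
    1 ≤ bOfA a p → 1 ≤ bOfA a q → bOfA a p ≠ bOfA a q → (∃ i ∈ Icc 1 7, bOfA a i = 0) →
      starKappa (bOfA a) p q * dualConstantTerm a + fanCoeff (bOfA a) q * dualConstantTerm (a + slotDown q) -
        fanCoeff (bOfA a) p * dualConstantTerm (a + slotDown p) = 0

/-- **PENCIL node for the dual constant term at ONE slot `s₀` (HYPOTHESIS; unsigned form).**  At every interior region
apex `a` (all slots `≥ 1`) with guard `W a`:
`pencilBase(b(a−DS))·CT(a−DS) − pencilApex(b(a−DS), s₀)·CT(a) + χ_{s₀}Π_{s₀}(b(a))·CT(a − s_{s₀}) = 0` — the one sign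
change relative to `DictPencil` is the flip `qSign_sub_dsUp` (the son flips twice).  Evidence: 896 instances per
slot of level `≤ 5`, exact. -/
def CTPencilSlot (W : (Fin 8 → ℤ) → Prop) (s₀ : ℕ) : Prop :=
  ∀ (a : Fin 8 → ℤ) (j : ℕ), RegionHyp a j → W a → (∀ m ∈ Icc 1 7, 1 ≤ bOfA a m) →
    pencilBase (bOfA (a - dsUp)) * dualConstantTerm (a - dsUp) - pencilApex (bOfA (a - dsUp)) s₀ * dualConstantTerm a
      + fanCoeff (bOfA a) s₀ * dualConstantTerm (a + slotDown s₀) = 0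

/-- **Terminal node (HYPOTHESIS; signed form).**  At every terminal region point `(N; x·𝟙_U)` with guard `W a`:
`Q(a) = qSign(a)·CT(a)`.  (At terminal points `Q` and `CT` are explicit products of binomial / trinomial
coefficients, e.g. `CT(N; x·𝟙_{{1}}) = C(N,x)`, `CT(N; x·𝟙_{{1,6}}) = N!/(x!²(N−2x)!)`; `Σp ≥ N − 3` on the region, so
the sign is the one of (17) from level `3` on, `neg_one_pow_toNat_eq_qSign`.) -/
def CTTerminal (W : (Fin 8 → ℤ) → Prop) : Prop :=
  ∀ (a : Fin 8 → ℤ) (j : ℕ), RegionHyp a j → W a → Terminal a → QOf a = qSign a * dualConstantTerm a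

/-- **Terminal node, unsigned form (HYPOTHESIS)**: CONJECTURE D-exact itself, `|Q(a)| = CT(a)`, at the terminal region
points of `W` only.  On a guard with `Σp ≥ 0` (e.g. the cone, `sumP_nonneg_of_cone`) it gives the signed form
(`ctTerminal_of_abs`). -/
def CTTerminalAbs (W : (Fin 8 → ℤ) → Prop) : Prop :=
  ∀ (a : Fin 8 → ℤ) (j : ℕ), RegionHyp a j → W a → Terminal a → |QOf a| = dualConstantTerm a

/-- The unsigned terminal node plus `Σp ≥ 0` on the guard gives the signed terminal node. (docstring added by the filing lane, P2 g7) -/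
theorem ctTerminal_of_abs (W : (Fin 8 → ℤ) → Prop) (hsum : ∀ (a : Fin 8 → ℤ) (j : ℕ), RegionHyp a j → W a → 0 ≤ sumP a)
    (h : CTTerminalAbs W) : CTTerminal W := by
  intro a j hr hW hT
  rw [QOf_eq_qSign_mul_abs (hsum a j hr hW), h a j hr hW hT]

/-- A STAR node stated for the pairs `p < q` gives all ordered pairs (`κ(q,p) = −κ(p,q)`). -/
theorem ctStarZero_of_lt (W : (Fin 8 → ℤ) → Prop)
    (h : ∀ (a : Fin 8 → ℤ) (j p q : ℕ), RegionHyp a j → W a → p ∈ Icc 1 7 → q ∈ Icc 1 7 → p < q →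
      1 ≤ bOfA a p → 1 ≤ bOfA a q → bOfA a p ≠ bOfA a q → (∃ i ∈ Icc 1 7, bOfA a i = 0) →
        starKappa (bOfA a) p q * dualConstantTerm a + fanCoeff (bOfA a) q * dualConstantTerm (a + slotDown q) -
          fanCoeff (bOfA a) p * dualConstantTerm (a + slotDown p) = 0) :
    CTStarZero W := by
  intro a j p q hr hW hp hq hp1 hq1 hne hz
  rcases lt_trichotomy p q with hlt | heq | hgt
  · exact h a j p q hr hW hp hq hlt hp1 hq1 hne hz
  · subst heq
    exact absurd rfl hne
  · have h' := h a j q p hr hW hq hp hgt hq1 hp1 hne.symm hz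
    have hκ : starKappa (bOfA a) p q = -starKappa (bOfA a) q p := by
      simp only [starKappa]
      ring
    rw [hκ]
    linear_combination -h'

end Summit.KontsevichZagierPeriods.Zeta5Search.Elimination
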